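import Mathlib
import Literature.AlgebraicGeometry.Resolution.CobordantGame
import Summits.ResolutionOfSingularities.ResolutionOfSingularities.Theorems.WeightedInvariantLocalWeightedDropSurfaceGermsWonOfS3ClassKeys
import Summits.ResolutionOfSingularities.ResolutionOfSingularities.Theorems.WeightedInvariantLocalWeightedDropWildPurelyInseparableReductionWon
import Summits.ResolutionOfSingularities.ResolutionOfSingularities.Theorems.WeightedInvariantLocalWeightedDropWildMonicSurfaceReductionWon

/-!
# `WeightedInvariant.LocalWeightedDrop`: EVERY SINGULAR SURFACE GERM IS WON — the N = 3 layer of the engine, unconditionally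

Crux item stmt-ResolutionOfSingularities-8899 `LocalWeightedDrop` (route `ResolutionOfSingularities/WeightedInvariant`), skeleton v31
(fb48e93459d3708f: the four remaining registered stubs are all in `N ≥ 4` variables).  [OURS · L1 W4.3, chain w43; BOOKKEEPING ONLY (filed by
stub worker 4, gen 4): the composition announced in the docstring of `surfaceGermsWon_of_S3ClassKeys` (stub worker 5 = res-D-pv-056, p-id in
that file), now that both S3 class keys are tree theorems — S3πM `stub_wildPurelyInseparableReductionWon` (res-L1-w43-lead-1, p510457, pure-power
polyhedron descent) and S3ρ `stub_wildMonicSurfaceReductionWon` (res-L1-w43-lead-1 with res-type-061 / res-L1-w43-stub-2 / res-type-013 /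
res-D-pv-058, p520169, monic polyhedron descent); S2 by `stub_monicDoublePointDescends` (lead-1).  No named fact enters.  NOT a statement of any
manuscript; AI-produced, gate-checked, weaker than expert review.]

* `surfaceGermsWon` — over an algebraically closed field of characteristic `p`, every singular `f ∈ k⟦x₀, x₁, x₂⟧` is won in the local
  weighted resolution game (`CobordantGame.Won k 3 f`): a positional weighted-blow-up strategy exists for every hypersurface SURFACE germ;
* `startsWon_of_le_three` — the same for every number `n ≤ 3` of variables (`lowStartsWon` for `n ≤ 2`);
* `lowerGermsWon_four` — the shared induction hypothesis `∀ m < 4, …` of the four registered `N = 4` / `N ≥ 5` stubs of v31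
  (`stub_wildWideApexFourStartsWon`, `stub_tameWideApexFourStartsWon`, …) at `N = 4`, DISCHARGED: from now on every N = 4 piece may be
  stated and proved without it.
-/

set_option linter.dupNamespace false -- mandated namespace of this single-conjunct summit

namespace Summit.ResolutionOfSingularities.ResolutionOfSingularities.Theorems

open Literature.AlgebraicGeometry.Resolution
open Literature.AlgebraicGeometry.Resolution.CobordantGame

/-- **EVERY SINGULAR SURFACE GERM IS WON** (the N = 3 layer of the engine `LocalWeightedDrop`, unconditionally): over an algebraically
closed field `k` of characteristic `p`, every `f ∈ k⟦x₀, x₁, x₂⟧` with `f ≠ 0`, `f(0) = 0` and no linear term is in the winning region of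
the local weighted resolution game.  Term: `surfaceGermsWon_of_S3ClassKeys stub_wildPurelyInseparableReductionWon stub_wildMonicSurfaceReductionWon`.
[OURS · L1 W4.3 · chain w43 milestone; credit: lead-1 (S2 key, S3πM, S3ρ), stub workers 1/2/3/5, res-type-061, -013, -083, res-D-pv-058, -005, -056 …] -/
theorem surfaceGermsWon (p : ℕ) (hp : p.Prime) (k : Type) [Field k] [CharP k p] [IsAlgClosed k] :
    ∀ f : MvPowerSeries (Fin 3) k, CobordantGame.IsSingular k f → CobordantGame.Won k 3 f :=
  surfaceGermsWon_of_S3ClassKeys stub_wildPurelyInseparableReductionWon stub_wildMonicSurfaceReductionWon p hp k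

/-- Every singular germ in at most three variables is won (algebraically closed field of characteristic `p`). -/
theorem startsWon_of_le_three (p : ℕ) (hp : p.Prime) (k : Type) [Field k] [CharP k p] [IsAlgClosed k] {n : ℕ} (hn : n ≤ 3)
    (f : MvPowerSeries (Fin n) k) (hf : CobordantGame.IsSingular k f) : CobordantGame.Won k n f := by
  rcases Nat.lt_or_ge n 3 with h | h
  · exact PlaneWon.lowStartsWon k (by omega) f hf
  · obtain rfl : n = 3 := le_antisymm hn h
    exact surfaceGermsWon p hp k f hf

/-- THE INDUCTION HYPOTHESIS OF THE `N = 4` STUBS, DISCHARGED: every singular germ in fewer than four variables is won. -/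
theorem lowerGermsWon_four (p : ℕ) (hp : p.Prime) (k : Type) [Field k] [CharP k p] [IsAlgClosed k] :
    ∀ m : ℕ, m < 4 → ∀ g : MvPowerSeries (Fin m) k, CobordantGame.IsSingular k g → CobordantGame.Won k m g :=
  fun _ hm g hg => startsWon_of_le_three p hp k (by omega) g hg

end Summit.ResolutionOfSingularities.ResolutionOfSingularities.Theorems
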